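import Mathlib

/-!
# Transversal DISC CHARTS in `ℝ³` and the pull-back of profile observables to the plane — plate t36c
# (P2a of LEAD ns-typeII-p2 g10's needle corollary for crux E `PowerGaugeEulerLiouville`, stmt-NavierStokesRegularity-19832)

LANDING PLATE prepared by nsreg-p2 g31 (cell ns-regularity-ideate; DIRECTOR-NS #168 (β) / #180 (4)) for a PROVER seat
(`--supports stmt-NavierStokesRegularity-19832 --as helper`); the planner lands nothing.  Mathlib only, 0 sorries.

CONTENT (pure finite-dimensional calculus; the glue between a `C¹` profile `V : ℝ³ → ℝ³` and the planar log-capacity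
lemma of plate t36 `…NeedleLogCapacity`):
* `discChart c e₁ e₂ : ℂ → ℝ³`, `z ↦ c + (re z) e₁ + (im z) e₂` — the transversal disc through the needle point `c`
  spanned by a frame `e₁, e₂`; its derivative `discChartL e₁ e₂ : ℂ →L[ℝ] ℝ³` (`hasFDerivAt_discChart`); for an
  ORTHONORMAL frame it is an isometric embedding (`norm_discChartL_apply`, `opNorm_discChartL_le`) and, when
  `c ⟂ e₁, e₂`, `‖discChart c e₁ e₂ z‖² = ‖c‖² + ‖z‖²` (`norm_discChart_sq`: the disc sits at radius `≥ ‖c‖`).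
* LINEAR OBSERVABLE `f z = ℓ (V (discChart z))` (`ℓ : ℝ³ →L[ℝ] ℝ`, e.g. the radial component `⟪e, ·⟫`):
  `HasFDerivAt f ((ℓ ∘L V') ∘L discChartL) z` and `‖f' z‖ ≤ ‖ℓ‖ ‖V'(discChart z)‖`
  (`hasFDerivAt_linearObservable`, `norm_linearObservableDeriv_le`).
* RADIAL-FLUX OBSERVABLE `f z = ⟪discChart z, V (discChart z)⟫` (the fast-inflow functional `⟪y, V y⟫` of the
  needle portrait): `HasFDerivAt` with `‖f' z‖ ≤ ‖V (discChart z)‖ + ‖discChart z‖ ‖V'(discChart z)‖`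
  (`hasFDerivAt_fluxObservable`, `norm_fluxObservableDeriv_le`), hence
  `‖f' z‖² ≤ 2‖V‖² + 2‖y‖²‖V'‖²` at `y = discChart z` (`norm_fluxObservableDeriv_sq_le`).
With t36's `core_radius_le_of_area` these give the needle in-radius bound `w ≤ δ·exp(−π(M−m)²/𝓔)` with `𝓔` the
disc slice of `‖∇V‖²` (linear observable) or of `2|V|² + 2|y|²‖∇V‖²` (flux observable) — the composition is P2b
(separate file, after t36 lands).  WHAT THIS IS NOT: no statement about Euler or Navier–Stokes; not crux E.
[folklore: chain rule]
-/

noncomputable section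

set_option linter.dupNamespace false

open scoped RealInnerProductSpace

namespace Summit.NavierStokesRegularity.NavierStokesRegularity.Theorems.PowerGaugeEulerLiouville.NeedleDiscChart

/-- The transversal disc chart through `c` spanned by the frame `e₁, e₂`. -/
def discChart (c e₁ e₂ : (EuclideanSpace ℝ (Fin 3))) : ℂ → (EuclideanSpace ℝ (Fin 3)) := fun z => c + z.re • e₁ + z.im • e₂

/-- Its (constant) derivative `h ↦ (re h) e₁ + (im h) e₂`. -/
def discChartL (e₁ e₂ : (EuclideanSpace ℝ (Fin 3))) : ℂ →L[ℝ] (EuclideanSpace ℝ (Fin 3)) := Complex.reCLM.smulRight e₁ + Complex.imCLM.smulRight e₂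

/-- Evaluation of the chart derivative: `L h = (re h) e₁ + (im h) e₂`. [folklore] -/
theorem discChartL_apply (e₁ e₂ : (EuclideanSpace ℝ (Fin 3))) (h : ℂ) : discChartL e₁ e₂ h = h.re • e₁ + h.im • e₂ := by
  simp [discChartL, ContinuousLinearMap.smulRight_apply]

/-- The chart is the centre plus its linear part. [folklore] -/
theorem discChart_eq (c e₁ e₂ : (EuclideanSpace ℝ (Fin 3))) : discChart c e₁ e₂ = fun z => c + discChartL e₁ e₂ z := by
  funext z
  rw [discChartL_apply, discChart, add_assoc]

/-- The disc chart is differentiable with the constant derivative `discChartL e₁ e₂`. [folklore: chain rule] -/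
theorem hasFDerivAt_discChart (c e₁ e₂ : (EuclideanSpace ℝ (Fin 3))) (z : ℂ) :
    HasFDerivAt (discChart c e₁ e₂) (discChartL e₁ e₂) z := by
  rw [discChart_eq]
  exact ((discChartL e₁ e₂).hasFDerivAt).const_add c

/-- The disc chart is continuous. [folklore] -/
theorem continuous_discChart (c e₁ e₂ : (EuclideanSpace ℝ (Fin 3))) : Continuous (discChart c e₁ e₂) := by
  rw [discChart_eq]
  exact continuous_const.add (discChartL e₁ e₂).continuous

/-- For an orthonormal frame the chart derivative is an isometric embedding. -/
theorem norm_discChartL_apply {e₁ e₂ : (EuclideanSpace ℝ (Fin 3))} (h₁ : ‖e₁‖ = 1) (h₂ : ‖e₂‖ = 1) (h12 : ⟪e₁, e₂⟫ = 0) (h : ℂ) :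
    ‖discChartL e₁ e₂ h‖ = ‖h‖ := by
  have hsq : ‖discChartL e₁ e₂ h‖ ^ 2 = ‖h‖ ^ 2 := by
    rw [discChartL_apply, ← real_inner_self_eq_norm_sq, inner_add_left, inner_add_right, inner_add_right,
      real_inner_smul_left, real_inner_smul_left, real_inner_smul_left, real_inner_smul_left,
      real_inner_smul_right, real_inner_smul_right, real_inner_smul_right, real_inner_smul_right,
      real_inner_self_eq_norm_sq, real_inner_self_eq_norm_sq, h₁, h₂, h12, real_inner_comm e₁ e₂, h12,
      Complex.sq_norm, Complex.normSq_apply]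
    ring
  exact (pow_left_inj₀ (norm_nonneg _) (norm_nonneg _) two_ne_zero).mp hsq

/-- For an orthonormal frame the chart derivative has operator norm `≤ 1`. [folklore] -/
theorem opNorm_discChartL_le {e₁ e₂ : (EuclideanSpace ℝ (Fin 3))} (h₁ : ‖e₁‖ = 1) (h₂ : ‖e₂‖ = 1) (h12 : ⟪e₁, e₂⟫ = 0) :
    ‖discChartL e₁ e₂‖ ≤ 1 :=
  ContinuousLinearMap.opNorm_le_bound _ zero_le_one fun h => by
    rw [norm_discChartL_apply h₁ h₂ h12, one_mul]

/-- When the centre is orthogonal to the frame, the disc sits at radius `≥ ‖c‖`: `‖y‖² = ‖c‖² + ‖z‖²`. -/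
theorem norm_discChart_sq {c e₁ e₂ : (EuclideanSpace ℝ (Fin 3))} (h₁ : ‖e₁‖ = 1) (h₂ : ‖e₂‖ = 1) (h12 : ⟪e₁, e₂⟫ = 0)
    (hc1 : ⟪c, e₁⟫ = 0) (hc2 : ⟪c, e₂⟫ = 0) (z : ℂ) :
    ‖discChart c e₁ e₂ z‖ ^ 2 = ‖c‖ ^ 2 + ‖z‖ ^ 2 := by
  have hL := norm_discChartL_apply h₁ h₂ h12 z
  have horth : ⟪c, discChartL e₁ e₂ z⟫ = 0 := by
    rw [discChartL_apply, inner_add_right, real_inner_smul_right, real_inner_smul_right, hc1, hc2]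
    ring
  have : discChart c e₁ e₂ z = c + discChartL e₁ e₂ z := by rw [discChart_eq]
  rw [this, ← real_inner_self_eq_norm_sq, inner_add_left, inner_add_right, inner_add_right,
    real_inner_comm c (discChartL e₁ e₂ z), horth, real_inner_self_eq_norm_sq, real_inner_self_eq_norm_sq, hL]
  ring

/-- When the centre is orthogonal to the frame: `‖c‖ ≤ ‖discChart c e₁ e₂ z‖`. [folklore] -/
theorem le_norm_discChart {c e₁ e₂ : (EuclideanSpace ℝ (Fin 3))} (h₁ : ‖e₁‖ = 1) (h₂ : ‖e₂‖ = 1) (h12 : ⟪e₁, e₂⟫ = 0)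
    (hc1 : ⟪c, e₁⟫ = 0) (hc2 : ⟪c, e₂⟫ = 0) (z : ℂ) : ‖c‖ ≤ ‖discChart c e₁ e₂ z‖ := by
  have h := norm_discChart_sq h₁ h₂ h12 hc1 hc2 z
  have : ‖c‖ ^ 2 ≤ ‖discChart c e₁ e₂ z‖ ^ 2 := by rw [h]; nlinarith [sq_nonneg ‖z‖]
  exact (pow_le_pow_iff_left₀ (norm_nonneg _) (norm_nonneg _) two_ne_zero).mp this

/-- When the centre is orthogonal to the frame: `‖discChart c e₁ e₂ z‖ ≤ √(‖c‖² + δ²)` on `‖z‖ ≤ δ`. [folklore] -/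
theorem norm_discChart_le {c e₁ e₂ : (EuclideanSpace ℝ (Fin 3))} (h₁ : ‖e₁‖ = 1) (h₂ : ‖e₂‖ = 1) (h12 : ⟪e₁, e₂⟫ = 0)
    (hc1 : ⟪c, e₁⟫ = 0) (hc2 : ⟪c, e₂⟫ = 0) {z : ℂ} {δ : ℝ} (hδ : 0 ≤ δ) (hz : ‖z‖ ≤ δ) :
    ‖discChart c e₁ e₂ z‖ ≤ Real.sqrt (‖c‖ ^ 2 + δ ^ 2) := by
  rw [← Real.sqrt_sq (norm_nonneg (discChart c e₁ e₂ z)), norm_discChart_sq h₁ h₂ h12 hc1 hc2]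
  exact Real.sqrt_le_sqrt (by nlinarith [norm_nonneg z])

/-! ## Linear observables `ℓ ∘ V ∘ discChart` -/

/-- Pull-back of a linear observable: `f = ℓ ∘ V ∘ discChart` has derivative `(ℓ ∘L V') ∘L discChartL`.
[folklore: chain rule] -/
theorem hasFDerivAt_linearObservable {V : (EuclideanSpace ℝ (Fin 3)) → (EuclideanSpace ℝ (Fin 3))} {V' : (EuclideanSpace ℝ (Fin 3)) →L[ℝ] (EuclideanSpace ℝ (Fin 3))} (ℓ : (EuclideanSpace ℝ (Fin 3)) →L[ℝ] ℝ) (c e₁ e₂ : (EuclideanSpace ℝ (Fin 3)))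
    {z : ℂ} (hV : HasFDerivAt V V' (discChart c e₁ e₂ z)) :
    HasFDerivAt (fun z => ℓ (V (discChart c e₁ e₂ z))) ((ℓ.comp V').comp (discChartL e₁ e₂)) z :=
  (ℓ.hasFDerivAt.comp _ hV).comp z (hasFDerivAt_discChart c e₁ e₂ z)

/-- The pulled-back derivative of a linear observable is bounded by `‖ℓ‖ ‖V'‖` (orthonormal frame). [folklore] -/
theorem norm_linearObservableDeriv_le {V' : (EuclideanSpace ℝ (Fin 3)) →L[ℝ] (EuclideanSpace ℝ (Fin 3))} (ℓ : (EuclideanSpace ℝ (Fin 3)) →L[ℝ] ℝ) {e₁ e₂ : (EuclideanSpace ℝ (Fin 3))}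
    (h₁ : ‖e₁‖ = 1) (h₂ : ‖e₂‖ = 1) (h12 : ⟪e₁, e₂⟫ = 0) :
    ‖(ℓ.comp V').comp (discChartL e₁ e₂)‖ ≤ ‖ℓ‖ * ‖V'‖ := by
  calc ‖(ℓ.comp V').comp (discChartL e₁ e₂)‖ ≤ ‖ℓ.comp V'‖ * ‖discChartL e₁ e₂‖ :=
        ContinuousLinearMap.opNorm_comp_le _ _
    _ ≤ ‖ℓ‖ * ‖V'‖ * 1 := by
        apply mul_le_mul (ContinuousLinearMap.opNorm_comp_le _ _) (opNorm_discChartL_le h₁ h₂ h12)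
          (norm_nonneg _) (mul_nonneg (norm_nonneg _) (norm_nonneg _))
    _ = ‖ℓ‖ * ‖V'‖ := mul_one _

/-- The radial-component observable: `ℓ = ⟪e, ·⟫` with `‖e‖ = 1` has `‖f'‖ ≤ ‖V'‖`. -/
theorem norm_radialObservableDeriv_le {V' : (EuclideanSpace ℝ (Fin 3)) →L[ℝ] (EuclideanSpace ℝ (Fin 3))} {e e₁ e₂ : (EuclideanSpace ℝ (Fin 3))} (he : ‖e‖ = 1)
    (h₁ : ‖e₁‖ = 1) (h₂ : ‖e₂‖ = 1) (h12 : ⟪e₁, e₂⟫ = 0) :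
    ‖((innerSL ℝ e).comp V').comp (discChartL e₁ e₂)‖ ≤ ‖V'‖ := by
  have h := norm_linearObservableDeriv_le (V' := V') (innerSL ℝ e) h₁ h₂ h12
  rwa [innerSL_apply_norm, he, one_mul] at h

/-! ## The radial-flux observable `z ↦ ⟪discChart z, V (discChart z)⟫` -/

/-- The derivative of the flux observable at `z`, as a continuous linear map `ℂ →L[ℝ] ℝ`:
`h ↦ ⟪L h, V y⟫ + ⟪y, V' (L h)⟫` with `y = discChart z`, `L = discChartL`. -/
def fluxObservableDeriv (c e₁ e₂ : (EuclideanSpace ℝ (Fin 3))) (z : ℂ) (Vy : (EuclideanSpace ℝ (Fin 3))) (V' : (EuclideanSpace ℝ (Fin 3)) →L[ℝ] (EuclideanSpace ℝ (Fin 3))) : ℂ →L[ℝ] ℝ :=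
  (innerSL ℝ Vy).comp (discChartL e₁ e₂) + (innerSL ℝ (discChart c e₁ e₂ z)).comp (V'.comp (discChartL e₁ e₂))

/-- Evaluation of the flux-observable derivative. [folklore] -/
theorem fluxObservableDeriv_apply (c e₁ e₂ : (EuclideanSpace ℝ (Fin 3))) (z : ℂ) (Vy : (EuclideanSpace ℝ (Fin 3))) (V' : (EuclideanSpace ℝ (Fin 3)) →L[ℝ] (EuclideanSpace ℝ (Fin 3))) (h : ℂ) :
    fluxObservableDeriv c e₁ e₂ z Vy V' h =
      ⟪Vy, discChartL e₁ e₂ h⟫ + ⟪discChart c e₁ e₂ z, V' (discChartL e₁ e₂ h)⟫ := by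
  simp [fluxObservableDeriv, innerSL_apply_apply]

/-- The flux observable `f z = ⟪discChart z, V (discChart z)⟫` has derivative `fluxObservableDeriv`. [folklore: product rule] -/
theorem hasFDerivAt_fluxObservable {V : (EuclideanSpace ℝ (Fin 3)) → (EuclideanSpace ℝ (Fin 3))} {V' : (EuclideanSpace ℝ (Fin 3)) →L[ℝ] (EuclideanSpace ℝ (Fin 3))} (c e₁ e₂ : (EuclideanSpace ℝ (Fin 3))) {z : ℂ}
    (hV : HasFDerivAt V V' (discChart c e₁ e₂ z)) :
    HasFDerivAt (fun z => ⟪discChart c e₁ e₂ z, V (discChart c e₁ e₂ z)⟫)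
      (fluxObservableDeriv c e₁ e₂ z (V (discChart c e₁ e₂ z)) V') z := by
  have hφ := hasFDerivAt_discChart c e₁ e₂ z
  have hVφ : HasFDerivAt (fun z => V (discChart c e₁ e₂ z)) (V'.comp (discChartL e₁ e₂)) z := hV.comp z hφ
  have h := hφ.inner ℝ hVφ
  refine h.congr_fderiv ?_
  ext h'
  simp only [fluxObservableDeriv_apply, ContinuousLinearMap.comp_apply, ContinuousLinearMap.prod_apply,
    fderivInnerCLM_apply]
  rw [real_inner_comm (V (discChart c e₁ e₂ z)) (discChartL e₁ e₂ h'), add_comm]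

/-- `‖f'‖ ≤ ‖V y‖ + ‖y‖ ‖V'‖` for the flux observable at `y = discChart z` (orthonormal frame). [folklore] -/
theorem norm_fluxObservableDeriv_le {c e₁ e₂ : (EuclideanSpace ℝ (Fin 3))} (h₁ : ‖e₁‖ = 1) (h₂ : ‖e₂‖ = 1) (h12 : ⟪e₁, e₂⟫ = 0)
    (z : ℂ) (Vy : (EuclideanSpace ℝ (Fin 3))) (V' : (EuclideanSpace ℝ (Fin 3)) →L[ℝ] (EuclideanSpace ℝ (Fin 3))) :
    ‖fluxObservableDeriv c e₁ e₂ z Vy V'‖ ≤ ‖Vy‖ + ‖discChart c e₁ e₂ z‖ * ‖V'‖ := by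
  refine ContinuousLinearMap.opNorm_le_bound _ (by positivity) fun h => ?_
  rw [fluxObservableDeriv_apply, Real.norm_eq_abs]
  have hL : ‖discChartL e₁ e₂ h‖ = ‖h‖ := norm_discChartL_apply h₁ h₂ h12 h
  calc |⟪Vy, discChartL e₁ e₂ h⟫ + ⟪discChart c e₁ e₂ z, V' (discChartL e₁ e₂ h)⟫|
      ≤ |⟪Vy, discChartL e₁ e₂ h⟫| + |⟪discChart c e₁ e₂ z, V' (discChartL e₁ e₂ h)⟫| := abs_add_le _ _
    _ ≤ ‖Vy‖ * ‖discChartL e₁ e₂ h‖ + ‖discChart c e₁ e₂ z‖ * ‖V' (discChartL e₁ e₂ h)‖ :=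
        add_le_add (abs_real_inner_le_norm _ _) (abs_real_inner_le_norm _ _)
    _ ≤ ‖Vy‖ * ‖h‖ + ‖discChart c e₁ e₂ z‖ * (‖V'‖ * ‖h‖) := by
        rw [hL]
        gcongr
        calc ‖V' (discChartL e₁ e₂ h)‖ ≤ ‖V'‖ * ‖discChartL e₁ e₂ h‖ := V'.le_opNorm _
          _ = ‖V'‖ * ‖h‖ := by rw [hL]
    _ = (‖Vy‖ + ‖discChart c e₁ e₂ z‖ * ‖V'‖) * ‖h‖ := by ring

/-- `‖f'‖² ≤ 2‖V y‖² + 2(‖y‖ ‖V'‖)²` for the flux observable (orthonormal frame). [folklore] -/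
theorem norm_fluxObservableDeriv_sq_le {c e₁ e₂ : (EuclideanSpace ℝ (Fin 3))} (h₁ : ‖e₁‖ = 1) (h₂ : ‖e₂‖ = 1) (h12 : ⟪e₁, e₂⟫ = 0)
    (z : ℂ) (Vy : (EuclideanSpace ℝ (Fin 3))) (V' : (EuclideanSpace ℝ (Fin 3)) →L[ℝ] (EuclideanSpace ℝ (Fin 3))) :
    ‖fluxObservableDeriv c e₁ e₂ z Vy V'‖ ^ 2 ≤ 2 * ‖Vy‖ ^ 2 + 2 * (‖discChart c e₁ e₂ z‖ * ‖V'‖) ^ 2 := by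
  have h := norm_fluxObservableDeriv_le (c := c) h₁ h₂ h12 z Vy V'
  have h0 : 0 ≤ ‖fluxObservableDeriv c e₁ e₂ z Vy V'‖ := norm_nonneg _
  nlinarith [sq_nonneg (‖Vy‖ - ‖discChart c e₁ e₂ z‖ * ‖V'‖), sq_abs ‖fluxObservableDeriv c e₁ e₂ z Vy V'‖]

end Summit.NavierStokesRegularity.NavierStokesRegularity.Theorems.PowerGaugeEulerLiouville.NeedleDiscChart
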